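import Summits.QuantumAdvantage.QuantumAdvantage.Theorems.CubicForrelationNearExactIsExactTwelveTypeOGe5964
import Summits.QuantumAdvantage.QuantumAdvantage.Theorems.CubicForrelationNearExactIsExactQuadWalshPlateau

/-!
# Crux `CubicForrelation.NearExactIsExact` (stmt-QuantumAdvantage-14043) — a weight-`768` cubic support on 12 bits lies in an affine
  HYPERPLANE (the `1.5·d_min` codewords of `RM(3,12)`, by Fourier moments — no Kasami–Tokura)

Certificate seat `b2b-cforr-cert` (gen 15).  HONEST FRAMING: a coding-theory lemma (standard axioms) about cubic Boolean functions on 12 bits,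
recorded as the missing brick for the TYPE-O branch BELOW `59/64` at `n = 12` (`#E = 768` with forced wild points, see AXIOMS.md gen 15);
classical content (it is the first half of the Kasami–Tokura description `x₁(x₂x₃ ⊕ x₄x₅)` of weight-`1.5d` cubics), proved here by a
self-contained moment argument.  Finite-slice bookkeeping, NOT summit progress.

`to15_weight768_hyperplane`: if `c : 𝔽₂¹² → 𝔽₂` is cubic with `#E = 768`, `E = {c = 1}`, then `Σ_{x∈E} (−1)^{x·z} = ±768` for some
`z ≠ 0`, i.e. `E` lies in one of the two affine hyperplanes `{x·z = const}` (`to15_weight768_in_hyperplane`).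
Proof.  `F(z) = Σ_{E}(−1)^{x·z} ∈ {0, ±256, ±768}` (half weights, `to15_halfweight`); `I(a) = #(E ∩ (E ⊕ a)) ∈ {0, 256, 768}` (the
derivative `c ⊕ c(·⊕a)` is quadratic, its Walsh value at `0` is `1024 + 4I(a)` and quadratic spectra are plateaued, `stub_quadWalshPlateau`);
Parseval `Σ_z F² = 2¹²·768`, the fourth moment `Σ_z F⁴ = 2¹²·Σ_a I(a)²`, and `Σ_a I(a) = 768²` combine, with `p = #{a : I(a) = 768} ≥ 1` and
`N₃ = #{z : F(z) = ±768}`, to `p = 192·N₃ − 256`; hence `N₃ ≥ 2` and some `z ≠ 0` has `F(z) = ±768`.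

References: T. Kasami, N. Tokura, *On the weight structure of Reed–Muller codes*, IEEE Trans. IT 16 (1970); MacWilliams–Sloane (1977)
Ch. 15; R. O'Donnell (2014) §3.3.  Everything below is proved from Mathlib and the tree; axioms are the standard three.
-/

set_option linter.dupNamespace false -- D-0017: single-problem summit ⇒ `QuantumAdvantage.QuantumAdvantage` by design

noncomputable section

namespace Summit.QuantumAdvantage.QuantumAdvantage.Theorems.CubicForrelation.NearExactIsExact

open Finset
open Literature.Computability.QuantumComplexity
open Literature.Computability.QuantumComplexity.BuzetChailloux (bxor zeroVec bxor_bxor_cancel_left bxor_zeroVec zeroVec_bxor bxor_comm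
  bxor_self twist_zeroVec_right)
open Literature.Computability.QuantumComplexity.DerivativeWalsh (W twist_bxor_left)
open Summit.QuantumAdvantage.QuantumAdvantage.Theorems.SignedCubicForrelationNotPrBPP (knf_isDegLeFun_ip)

/-! ### Character sums: the five values -/

/-- **Character sums over a weight-768 cubic support take the values `0, ±256, ±768` only** (`768 − 2·#{c = 1, x·z odd}` with
`to15_halfweight`). [this work] -/
theorem to15_char_values (c : (Fin (6 + 6) → Bool) → Bool) (hc : IsDegLeFun 3 c) (h768 : #(univ.filter fun x => c x = true) = 768)
    (z : Fin (6 + 6) → Bool) :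
    ∃ m : ℤ, (m = 3 ∨ m = 1 ∨ m = 0 ∨ m = -1 ∨ m = -3) ∧ ∑ x ∈ univ.filter (fun x => c x = true), twist x z = 256 * (m : ℝ) := by
  classical
  set ℓ : (Fin (6 + 6) → Bool) → Bool := fun x => decide (Odd #(univ.filter fun i => x i && z i)) with hℓdef
  have hℓ : IsDegLeFun 1 ℓ := knf_isDegLeFun_ip z
  have htw : ∀ x, twist x z = 1 - 2 * (if ℓ x = true then (1 : ℝ) else 0) := by
    intro x
    rw [vg_twist_eq_signOf x z]
    change signOf (ℓ x) = 1 - 2 * (if ℓ x = true then (1 : ℝ) else 0)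
    unfold signOf
    cases ℓ x <;> norm_num
  have hsum : ∑ x ∈ univ.filter (fun x => c x = true), twist x z =
      768 - 2 * (#(univ.filter fun x => (c x && ℓ x) = true) : ℝ) := by
    rw [sum_congr rfl fun x _ => htw x, sum_sub_distrib, sum_const, h768, ← mul_sum, sum_boole]
    have e : (univ.filter fun x : Fin (6 + 6) → Bool => c x = true).filter (fun x => ℓ x = true) =
        univ.filter fun x => (c x && ℓ x) = true := by
      ext x; simp only [mem_filter, mem_univ, true_and]; cases c x <;> cases ℓ x <;> simp
    rw [e]; norm_num
  rw [hsum]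
  rcases to15_halfweight c ℓ hc hℓ h768 with h | h | h | h | h <;> rw [h]
  · exact ⟨3, Or.inl rfl, by norm_num⟩
  · exact ⟨1, Or.inr (Or.inl rfl), by norm_num⟩
  · exact ⟨0, Or.inr (Or.inr (Or.inl rfl)), by norm_num⟩
  · exact ⟨-1, Or.inr (Or.inr (Or.inr (Or.inl rfl))), by norm_num⟩
  · exact ⟨-3, Or.inr (Or.inr (Or.inr (Or.inr rfl))), by norm_num⟩

/-! ### The hyperplane theorem -/

/-- **A weight-768 cubic support on 12 bits lies in an affine hyperplane**: some `z ≠ 0` has `Σ_{c(x)=1} (−1)^{x·z} = ±768`.  Fourier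
moments: Parseval, the fourth moment `Σ F⁴ = 2¹² Σ_a #(E ∩ (E⊕a))²`, the plateau of the quadratic derivatives, and the five character values.
[this work] -/
theorem to15_weight768_hyperplane (c : (Fin (6 + 6) → Bool) → Bool) (hc : IsDegLeFun 3 c)
    (h768 : #(univ.filter fun x => c x = true) = 768) :
    ∃ z : Fin (6 + 6) → Bool, z ≠ zeroVec ∧
      (∑ x ∈ univ.filter (fun x => c x = true), twist x z = 768 ∨ ∑ x ∈ univ.filter (fun x => c x = true), twist x z = -768) := by
  classical
  set S := univ.filter (fun x : Fin (6 + 6) → Bool => c x = true) with hSdef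
  have hmemS : ∀ x, x ∈ S ↔ c x = true := fun x => by simp [hSdef]
  set F : (Fin (6 + 6) → Bool) → ℝ := fun z => ∑ x ∈ S, twist x z with hFdef
  /- (A) the five values of `F` -/
  have hFval : ∀ z, ∃ m : ℤ, (m = 3 ∨ m = 1 ∨ m = 0 ∨ m = -1 ∨ m = -3) ∧ F z = 256 * (m : ℝ) :=
    fun z => to15_char_values c hc h768 z
  /- (C) Parseval `Σ F² = 2¹²·768` -/
  set A : (Fin (6 + 6) → Bool) → ℝ := fun x => if x ∈ S then 1 else 0 with hAdef
  have hWA : ∀ z, W A z = F z := by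
    intro z
    unfold W
    have e : ∀ x, A x * twist x z = if x ∈ S then twist x z else 0 := fun x => by
      simp only [A]; split_ifs <;> simp
    rw [sum_congr rfl fun x _ => e x, ← sum_filter, filter_mem_eq_inter, univ_inter]
  have hPars : ∑ z, F z ^ 2 = 4096 * 768 := by
    have h := fp_parseval_pm A S (fun x hx => Or.inl (by simp [A, hx])) (fun x hx => by simp [A, hx])
    rw [sum_congr rfl fun z _ => by rw [hWA z], h768] at h
    rw [h]; norm_num
  /- (B) `I(a) = #(E ∩ (E ⊕ a)) ∈ {0, 256, 768}` -/
  set I : (Fin (6 + 6) → Bool) → ℕ := fun a => #(S.filter fun x => bxor x a ∈ S) with hIdef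
  have hIle : ∀ a, I a ≤ 768 := fun a => (card_filter_le _ _).trans h768.le
  have hI0 : I zeroVec = 768 := by
    simp only [I]
    rw [filter_true_of_mem (fun x hx => by rw [bxor_zeroVec]; exact hx), h768]
  have hind : ∀ x, signOf (c x) = 1 - 2 * (if x ∈ S then (1 : ℝ) else 0) := by
    intro x
    by_cases hx : x ∈ S
    · rw [if_pos hx]; have hc' := (hmemS x).1 hx; unfold signOf; rw [if_pos hc']; norm_num
    · rw [if_neg hx]
      have hc' : ¬ c x = true := fun h => hx ((hmemS x).2 h)
      unfold signOf; rw [if_neg hc']; norm_num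
  have hIval : ∀ a, I a = 0 ∨ I a = 256 ∨ I a = 768 := by
    intro a
    have hD : IsDegLeFun 2 (fun x => c x ^^ c (bxor x a)) := stub_derivDegree (6 + 6) 2 c a hc
    obtain ⟨s, hs⟩ := stub_quadWalshPlateau (6 + 6) _ hD
    -- the Walsh value at `0` of the derivative: `1024 + 4 I(a)`
    have hW0 : W (fun x => signOf (c x ^^ c (bxor x a))) zeroVec = 1024 + 4 * (I a : ℝ) := by
      unfold W
      simp_rw [twist_zeroVec_right, mul_one, signOf_xor]
      rw [sum_congr rfl fun x _ => by rw [hind x, hind (bxor x a)]]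
      have e1 : ∀ x : Fin (6 + 6) → Bool, (1 - 2 * (if x ∈ S then (1 : ℝ) else 0)) * (1 - 2 * (if bxor x a ∈ S then (1 : ℝ) else 0)) =
          1 - 2 * (if x ∈ S then (1 : ℝ) else 0) - 2 * (if bxor x a ∈ S then (1 : ℝ) else 0) +
            4 * (if (x ∈ S ∧ bxor x a ∈ S) then (1 : ℝ) else 0) := by
        intro x; by_cases h1 : x ∈ S <;> by_cases h2 : bxor x a ∈ S <;> norm_num [h1, h2]
      rw [sum_congr rfl fun x _ => e1 x, sum_add_distrib, sum_sub_distrib, sum_sub_distrib, sum_const, card_univ, Fintype.card_fun,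
        Fintype.card_bool, Fintype.card_fin, ← mul_sum, ← mul_sum, ← mul_sum, sum_boole, sum_boole, sum_boole]
      have c1 : #(univ.filter fun x : Fin (6 + 6) → Bool => x ∈ S) = 768 := by
        rw [show (univ.filter fun x : Fin (6 + 6) → Bool => x ∈ S) = S by ext x; simp, h768]
      have c2 : #(univ.filter fun x : Fin (6 + 6) → Bool => bxor x a ∈ S) = 768 := by
        rw [← h768]
        refine card_nbij' (fun x => bxor x a) (fun x => bxor x a) (fun x hx => ?_) (fun x hx => ?_)
          (fun x _ => by show bxor (bxor x a) a = x; rw [iw_bxor_assoc, bxor_self, bxor_zeroVec])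
          (fun x _ => by show bxor (bxor x a) a = x; rw [iw_bxor_assoc, bxor_self, bxor_zeroVec])
        · rw [mem_coe, mem_filter] at hx; exact hx.2
        · rw [mem_coe] at hx; rw [mem_coe, mem_filter, iw_bxor_assoc, bxor_self, bxor_zeroVec]; exact ⟨mem_univ _, hx⟩
      have c3 : #(univ.filter fun x : Fin (6 + 6) → Bool => x ∈ S ∧ bxor x a ∈ S) = I a := by
        simp only [I]; congr 1; ext x; simp
      rw [c1, c2, c3]
      norm_num
    rcases hs zeroVec with h0 | hsq
    · exfalso
      rw [hW0] at h0
      have : (0 : ℝ) ≤ I a := by positivity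
      linarith
    · rw [hW0] at hsq
      have h4 : (4 : ℝ) ^ s = ((2 : ℝ) ^ s) ^ 2 := by
        rw [show (4 : ℝ) = 2 ^ 2 by norm_num, ← pow_mul, mul_comm, pow_mul]
      rw [h4] at hsq
      have hpos : (0 : ℝ) ≤ 1024 + 4 * (I a : ℝ) := by positivity
      have h2s : 1024 + 4 * (I a : ℝ) = (2 : ℝ) ^ s := (pow_left_inj₀ hpos (by positivity) (by norm_num : (2 : ℕ) ≠ 0)).1 hsq
      have hIle' : (I a : ℝ) ≤ 768 := by exact_mod_cast hIle a
      have hs_le : s ≤ 12 := by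
        by_contra h
        push Not at h
        have : (2 : ℝ) ^ 13 ≤ 2 ^ s := pow_le_pow_right₀ (by norm_num) h
        norm_num at this; linarith
      have hs_ge : 10 ≤ s := by
        by_contra h
        push Not at h
        have : (2 : ℝ) ^ s ≤ 2 ^ 9 := pow_le_pow_right₀ (by norm_num) (by omega)
        have : (0 : ℝ) ≤ I a := by positivity
        norm_num at *; linarith
      interval_cases s
      · left
        have h' : (I a : ℝ) = 0 := by rw [show (2 : ℝ) ^ 10 = 1024 by norm_num] at h2s; linarith
        exact_mod_cast h'
      · right; left
        have h' : (I a : ℝ) = 256 := by rw [show (2 : ℝ) ^ 11 = 2048 by norm_num] at h2s; linarith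
        exact_mod_cast h'
      · right; right
        have h' : (I a : ℝ) = 768 := by rw [show (2 : ℝ) ^ 12 = 4096 by norm_num] at h2s; linarith
        exact_mod_cast h'
  /- (D) the fourth moment `Σ_z F⁴ = 2¹² · #Q`, `#Q = Σ_a J(a)²`, `J = I`, `Σ_a J(a) = 768²` -/
  set P2 := S ×ˢ S with hP2
  set J : (Fin (6 + 6) → Bool) → ℕ := fun a => #(P2.filter fun q => bxor q.1 q.2 = a) with hJdef
  have hJI : ∀ a, J a = I a := by
    intro a
    simp only [J, I]
    refine card_nbij' (fun q => q.1) (fun x => (x, bxor x a)) (fun q hq => ?_) (fun x hx => ?_) (fun q hq => ?_) (fun x _ => rfl)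
    · rw [mem_coe, mem_filter, hP2, mem_product] at hq
      rw [mem_coe, mem_filter]
      refine ⟨hq.1.1, ?_⟩
      rw [← hq.2, bxor_bxor_cancel_left]; exact hq.1.2
    · rw [mem_coe, mem_filter] at hx
      rw [mem_coe, mem_filter, hP2, mem_product]
      exact ⟨⟨hx.1, hx.2⟩, bxor_bxor_cancel_left _ _⟩
    · rw [mem_coe, mem_filter] at hq
      obtain ⟨-, h⟩ := hq
      show (q.1, bxor q.1 a) = q
      rw [← h, bxor_bxor_cancel_left]
  have hJsum : ∑ a, (J a : ℝ) = 768 * 768 := by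
    have h := card_eq_sum_card_fiberwise (s := P2) (t := (univ : Finset (Fin (6 + 6) → Bool))) (f := fun q => bxor q.1 q.2)
      (fun q _ => mem_univ _)
    rw [hP2, card_product, h768] at h
    have h' : ((768 * 768 : ℕ) : ℝ) = ∑ a, (J a : ℝ) := by rw [h]; push_cast; rfl
    rw [← h']; norm_num
  set Q := (P2 ×ˢ P2).filter (fun q => bxor q.1.1 q.1.2 = bxor q.2.1 q.2.2) with hQdef
  have hQ : (#Q : ℝ) = ∑ a, (J a : ℝ) ^ 2 := by
    have h := card_eq_sum_card_fiberwise (s := Q) (t := (univ : Finset (Fin (6 + 6) → Bool))) (f := fun q => bxor q.1.1 q.1.2)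
      (fun q _ => mem_univ _)
    rw [h]; push_cast
    refine sum_congr rfl fun a _ => ?_
    have e : Q.filter (fun q => bxor q.1.1 q.1.2 = a) = (P2.filter fun q => bxor q.1 q.2 = a) ×ˢ (P2.filter fun q => bxor q.1 q.2 = a) := by
      ext q
      simp only [hQdef, mem_filter, mem_product]
      constructor
      · rintro ⟨⟨hq, heq⟩, ha⟩; exact ⟨⟨hq.1, ha⟩, hq.2, by rw [← heq, ha]⟩
      · rintro ⟨⟨h1, ha1⟩, h2, ha2⟩; exact ⟨⟨⟨h1, h2⟩, by rw [ha1, ha2]⟩, ha1⟩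
    rw [e, card_product]; push_cast; ring
  have hF2 : ∀ z, F z ^ 2 = ∑ q ∈ P2, twist (bxor q.1 q.2) z := by
    intro z
    rw [sq, hFdef, sum_mul_sum, hP2, sum_product]
    exact sum_congr rfl fun x _ => sum_congr rfl fun y _ => (twist_bxor_left x y z).symm
  have hF4 : ∑ z, F z ^ 4 = 4096 * (#Q : ℝ) := by
    have e1 : ∀ z, F z ^ 4 = ∑ q ∈ P2 ×ˢ P2, twist (bxor (bxor q.1.1 q.1.2) (bxor q.2.1 q.2.2)) z := by
      intro z
      rw [show F z ^ 4 = F z ^ 2 * F z ^ 2 by ring, hF2 z, sum_mul_sum, Finset.sum_product (s := P2) (t := P2)]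
      exact sum_congr rfl fun q _ => sum_congr rfl fun q' _ => (twist_bxor_left _ _ z).symm
    rw [sum_congr rfl fun z _ => e1 z, sum_comm]
    rw [sum_congr rfl fun q _ => Simon.sum_twist (bxor (bxor q.1.1 q.1.2) (bxor q.2.1 q.2.2))]
    rw [← sum_filter, sum_const, nsmul_eq_mul]
    have e2 : (P2 ×ˢ P2).filter (fun q => bxor (bxor q.1.1 q.1.2) (bxor q.2.1 q.2.2) = fun _ => false) = Q := by
      rw [hQdef]
      refine filter_congr fun q _ => ?_
      constructor
      · intro h
        have := congrArg (bxor (bxor q.1.1 q.1.2)) h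
        rw [bxor_bxor_cancel_left] at this
        rw [this]; exact (bxor_zeroVec _).symm
      · intro h; rw [h]; exact bxor_self _
    rw [e2, show (2 : ℝ) ^ (6 + 6) = 4096 by norm_num, mul_comm]
  /- (E) counting: `p = #{I = 768} ≥ 1`, `N₃ = #{F = ±768}`; the moments give `p + 384 = 192 N₃ + 128` -/
  -- pointwise polynomial identities on the finite value sets
  have hIsq : ∀ a, ((I a : ℝ)) ^ 2 = 256 * (I a : ℝ) + 393216 * (if I a = 768 then (1 : ℝ) else 0) := by
    intro a; rcases hIval a with h | h | h <;> simp [h] <;> norm_num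
  have hF4pt : ∀ z, F z ^ 4 = 65536 * F z ^ 2 + 309237645312 * (if (F z = 768 ∨ F z = -768) then (1 : ℝ) else 0) := by
    intro z
    obtain ⟨m, hm, hFz⟩ := hFval z
    rw [hFz]
    rcases hm with rfl | rfl | rfl | rfl | rfl <;> norm_num
  have hIsum : ∑ a, (I a : ℝ) = 589824 := by
    have e : ∀ a, (I a : ℝ) = (J a : ℝ) := fun a => by rw [hJI a]
    rw [sum_congr rfl fun a _ => e a, hJsum]; norm_num
  have hI2sum : ∑ a, (I a : ℝ) ^ 2 = 256 * 589824 + 393216 * (#(univ.filter fun a : Fin (6 + 6) → Bool => I a = 768) : ℝ) := by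
    rw [sum_congr rfl fun a _ => hIsq a, sum_add_distrib, ← mul_sum, ← mul_sum, hIsum, sum_boole]
  have hF4sum : ∑ z, F z ^ 4 = 65536 * (4096 * 768) +
      309237645312 * (#(univ.filter fun z : Fin (6 + 6) → Bool => (F z = 768 ∨ F z = -768)) : ℝ) := by
    rw [sum_congr rfl fun z _ => hF4pt z, sum_add_distrib, ← mul_sum, ← mul_sum, hPars, sum_boole]
  have hQJ : (#Q : ℝ) = ∑ a, (I a : ℝ) ^ 2 := by rw [hQ]; exact sum_congr rfl fun a _ => by rw [hJI a]
  -- `p ≥ 1`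
  have hp1 : 1 ≤ #(univ.filter fun a : Fin (6 + 6) → Bool => I a = 768) :=
    card_pos.2 ⟨zeroVec, mem_filter.2 ⟨mem_univ _, hI0⟩⟩
  -- `N₃ ≥ 2`
  have hN3 : 2 ≤ #(univ.filter fun z : Fin (6 + 6) → Bool => (F z = 768 ∨ F z = -768)) := by
    have key := hF4
    rw [hF4sum, hQJ, hI2sum] at key
    have hp1' : (1 : ℝ) ≤ #(univ.filter fun a : Fin (6 + 6) → Bool => I a = 768) := by exact_mod_cast hp1
    have h2 : (2 : ℝ) ≤ #(univ.filter fun z : Fin (6 + 6) → Bool => (F z = 768 ∨ F z = -768)) := by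
      by_contra hlt
      push Not at hlt
      have hN : (#(univ.filter fun z : Fin (6 + 6) → Bool => (F z = 768 ∨ F z = -768)) : ℝ) ≤ 1 := by
        have : #(univ.filter fun z : Fin (6 + 6) → Bool => (F z = 768 ∨ F z = -768)) ≤ 1 := by
          by_contra h; push Not at h
          have : (2 : ℝ) ≤ #(univ.filter fun z : Fin (6 + 6) → Bool => (F z = 768 ∨ F z = -768)) := by exact_mod_cast h
          linarith
        exact_mod_cast this
      nlinarith
    exact_mod_cast h2
  -- a second point of `{F = ±768}` besides `0`
  obtain ⟨z, hz, hz0⟩ := exists_mem_ne hN3 zeroVec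
  exact ⟨z, hz0, (mem_filter.1 hz).2⟩

/-- **Corollary: `E` lies in an affine hyperplane** `{x : (−1)^{x·z} = t}`, `z ≠ 0`, `t = ±1`. [this work] -/
theorem to15_weight768_in_hyperplane (c : (Fin (6 + 6) → Bool) → Bool) (hc : IsDegLeFun 3 c)
    (h768 : #(univ.filter fun x => c x = true) = 768) :
    ∃ (z : Fin (6 + 6) → Bool) (t : ℝ), z ≠ zeroVec ∧ (t = 1 ∨ t = -1) ∧ ∀ x, c x = true → twist x z = t := by
  classical
  obtain ⟨z, hz0, hF⟩ := to15_weight768_hyperplane c hc h768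
  have htw : ∀ x, twist x z = 1 ∨ twist x z = -1 := fun x => Simon.twist_eq_one_or x z
  rcases hF with h | h
  · refine ⟨z, 1, hz0, Or.inl rfl, fun x hx => ?_⟩
    have hsum0 : ∑ y ∈ univ.filter (fun y => c y = true), (1 - twist y z) = 0 := by
      rw [sum_sub_distrib, sum_const, nsmul_eq_mul, h768, h]; norm_num
    have hnn : ∀ y ∈ univ.filter (fun y => c y = true), (0 : ℝ) ≤ 1 - twist y z := fun y _ => by
      rcases htw y with h1 | h1 <;> rw [h1] <;> norm_num
    have := (sum_eq_zero_iff_of_nonneg hnn).1 hsum0 x (mem_filter.2 ⟨mem_univ _, hx⟩)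
    linarith
  · refine ⟨z, -1, hz0, Or.inr rfl, fun x hx => ?_⟩
    have hsum0 : ∑ y ∈ univ.filter (fun y => c y = true), (1 + twist y z) = 0 := by
      rw [sum_add_distrib, sum_const, nsmul_eq_mul, h768, h]; norm_num
    have hnn : ∀ y ∈ univ.filter (fun y => c y = true), (0 : ℝ) ≤ 1 + twist y z := fun y _ => by
      rcases htw y with h1 | h1 <;> rw [h1] <;> norm_num
    have := (sum_eq_zero_iff_of_nonneg hnn).1 hsum0 x (mem_filter.2 ⟨mem_univ _, hx⟩)
    linarith

end Summit.QuantumAdvantage.QuantumAdvantage.Theorems.CubicForrelation.NearExactIsExact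

end
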